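import Summits.ValiantsHypothesis.ValiantsHypothesis.Theses.BarrierLever

/-!
# Route BarrierLever — glue item `SplitReductionSufficesForTransversal`
# (stmt-ValiantsHypothesis-19617), PROVED

Closing file (`--workitem stmt-ValiantsHypothesis-19617`; cell valiant-natproofs, rung V4, 𝒟-side;
prover seat valiant-natproofs-prover gen 7; item typed by planner p1-g10). The item is the glue
`TransversalLiteralPairSplit → TransversalTwinFreeReduction →
TransversalMinorsNonsingularOnIrreducibleLayouts → TransversalMinorLayoutsNonsingular`
(R1, item 19587 → R2, item 19588 → the irreducible core, item 19616 → TT, item 19152): the two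
algebraic reductions together with TT on the R1/R2-irreducible core give TT for every injective
layout.

Conventions are those of TT (item 19152): row literal `castAdd a` if `a ∈ x` else `natAdd a`,
column literal `natAdd c` if `c ∈ y` else `castAdd c`, `Θ_H[x, y] = det H[ρ_x, κ_y]`; a layout
`u, w : Fin r → Finset (Fin h)` is GOOD when some `H` makes `(Θ_H[u_i, w_j])_{i,j}` nonsingular
(all statements below spell this out; no definition is introduced).

**Proof (the planner's plan).** Induction on the dimension `h`, inner strong induction on the size
`r` of the layout.
* Dimension `0` (`good_dim_zero`): an injective layout has `r ≤ 1` (there is one finset of `Fin 0`),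
  and for `r ≤ 1` the layout matrix is the `r × r` all-ones matrix (its entries are `0 × 0`
  determinants), which is nonsingular.
* Dimension `h + 1`, size `r` (`good_succ`): if `r = 0` the layout matrix is empty. Otherwise:
  (A) if some literal classes have EQUAL sizes — `#{i : (a ∈ u_i) = β} = #{j : (c ∈ w_j) = γ}` —
  we may take the common size `k ≥ 1` (if it is `0`, flip both bits: the complementary classes
  have the common size `r ≥ 1`, `card_class_not`); enumerate the rows with the `β`-class first and
  the columns with the `γ`-class first (`exists_equiv_classFirst`: `Fin (k + m) ≃ Fin r`,
  `m = r - k`), apply R1 to the re-indexed layout — its first hypothesis GOOD(projected `k`-block,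
  dimension `h`) is the outer induction hypothesis (the projection deleting `a` is injective on a
  class of rows with equal `a`-bit, `proj_injective_of_class`), its second hypothesis
  GOOD(complementary `m`-block, dimension `h + 1`) is the inner induction hypothesis (`m < r`) —
  and transport GOOD back along the re-indexing (`good_of_reindex`: re-indexing rows and columns
  by bijections multiplies the determinant by a sign, `det_ne_zero_of_submatrix_equiv`);
  (B) else, if some coordinate pair `(a, c)` has both deletions injective, R2 and the outer
  induction hypothesis give GOOD;
  (C) else the layout is irreducible by definition and the core hypothesis gives GOOD.

WHAT THIS IS NOT: bookkeeping only (R2 is a tree theorem, `…LiteralLift.transversalTwinFreeReduction`,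
val-np-p1; R1 is being ported by val-np-p1; the CORE item 19616 is an OPEN conjecture); nothing
here on TT / TNS / item 19717 unconditionally, on crux stmt-ValiantsHypothesis-14610, or on `VP`
versus `VNP`.
-/

-- layout Summits/ValiantsHypothesis/ValiantsHypothesis forces the duplicated namespace component
set_option linter.dupNamespace false

namespace Summit.ValiantsHypothesis.ValiantsHypothesis.Theorems.BarrierLever.SplitGlue

open Finset
open Summit.ValiantsHypothesis.ValiantsHypothesis.Theses.BarrierLever
  (TransversalLiteralPairSplit TransversalTwinFreeReduction
    TransversalMinorsNonsingularOnIrreducibleLayouts TransversalMinorLayoutsNonsingular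
    SplitReductionSufficesForTransversal)

/-! ## 1. Generic tools -/

/-- Re-indexing rows and columns of a square matrix along two equivalences multiplies the
determinant by a sign; in particular nonvanishing transfers. -/
theorem det_ne_zero_of_submatrix_equiv {m n : Type*} [Fintype m] [Fintype n] [DecidableEq m]
    [DecidableEq n] (A : Matrix n n ℂ) (e₁ e₂ : m ≃ n) (hA : (A.submatrix e₁ e₂).det ≠ 0) :
    A.det ≠ 0 := by
  have hsub : A.submatrix e₁ e₂ = (A.submatrix e₁ e₁).submatrix id (e₂.trans e₁.symm) := by
    ext i j
    simp only [Matrix.submatrix_apply, id_eq, Equiv.trans_apply, Equiv.apply_symm_apply]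
  rw [hsub, Matrix.det_permute', Matrix.det_submatrix_equiv_self] at hA
  exact right_ne_zero_of_mul hA

/-- Enumerate `Fin r` with a given finset `A` of size `k` first and its complement (size `m`)
last: an equivalence `Fin (k + m) ≃ Fin r` sending the `castAdd` block into `A` and the `natAdd`
block into `Aᶜ`. -/
theorem exists_equiv_classFirst {r k m : ℕ} (A : Finset (Fin r)) (hA : A.card = k)
    (hAc : Aᶜ.card = m) :
    ∃ ρ : Fin (k + m) ≃ Fin r, (∀ i : Fin k, ρ (Fin.castAdd m i) ∈ A) ∧
      (∀ i : Fin m, ρ (Fin.natAdd k i) ∉ A) := by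
  set f : Fin k → Fin r := fun i => A.orderEmbOfFin hA i with hf_def
  set g : Fin m → Fin r := fun i => Aᶜ.orderEmbOfFin hAc i with hg_def
  have hf : ∀ i, f i ∈ A := fun i => Finset.orderEmbOfFin_mem A hA i
  have hg : ∀ i, g i ∉ A := fun i => Finset.mem_compl.mp (Finset.orderEmbOfFin_mem Aᶜ hAc i)
  have hinj : Function.Injective (Fin.append f g) := by
    intro x y hxy
    induction x using Fin.addCases with
    | left i =>
      induction y using Fin.addCases with
      | left j =>
        simp only [Fin.append_left] at hxy
        exact congrArg _ ((A.orderEmbOfFin hA).injective hxy)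
      | right j =>
        simp only [Fin.append_left, Fin.append_right] at hxy
        exact absurd (hxy ▸ hf i) (hg j)
    | right i =>
      induction y using Fin.addCases with
      | left j =>
        simp only [Fin.append_left, Fin.append_right] at hxy
        exact absurd (hxy.symm ▸ hf j) (hg i)
      | right j =>
        simp only [Fin.append_right] at hxy
        exact congrArg _ ((Aᶜ.orderEmbOfFin hAc).injective hxy)
  have hcard : Fintype.card (Fin (k + m)) = Fintype.card (Fin r) := by
    have h1 := Finset.card_add_card_compl A
    simp only [Fintype.card_fin] at h1 ⊢
    omega
  have hbij : Function.Bijective (Fin.append f g) :=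
    (Fintype.bijective_iff_injective_and_card _).mpr ⟨hinj, hcard⟩
  refine ⟨Equiv.ofBijective _ hbij, fun i => ?_, fun i => ?_⟩
  · rw [Equiv.ofBijective_apply, Fin.append_left]
    exact hf i
  · rw [Equiv.ofBijective_apply, Fin.append_right]
    exact hg i

/-- Sizes of complementary literal classes: the rows whose `a`-bit is `!β` are the complement of
the rows whose `a`-bit is `β`. -/
theorem card_class_not {r n : ℕ} (u : Fin r → Finset (Fin n)) (a : Fin n) (β : Bool) :
    (Finset.univ.filter fun i : Fin r => (a ∈ u i ↔ (!β) = true)).card =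
      r - (Finset.univ.filter fun i : Fin r => (a ∈ u i ↔ β = true)).card := by
  have hc := Finset.card_filter_add_card_filter_not (s := (Finset.univ : Finset (Fin r)))
    (fun i : Fin r => (a ∈ u i ↔ β = true))
  have he : (Finset.univ.filter fun i : Fin r => (a ∈ u i ↔ (!β) = true)) =
      Finset.univ.filter fun i : Fin r => ¬ (a ∈ u i ↔ β = true) := by
    refine Finset.filter_congr (fun i _ => ?_)
    cases β <;> simp
  rw [he]
  simp only [Finset.card_univ, Fintype.card_fin] at hc
  omega

/-- A bit that is not `β` is `!β` (as a membership test). -/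
theorem iff_eq_false_of_not_iff {P : Prop} {β : Bool} (hP : ¬ (P ↔ β = true)) :
    (P ↔ β = false) := by
  cases β <;> simp_all

/-- Deleting the coordinate `a` is injective on a family of distinct row points with the SAME
`a`-bit. -/
theorem proj_injective_of_class {h r k : ℕ} (u : Fin r → Finset (Fin (h + 1)))
    (hu : Function.Injective u) (a : Fin (h + 1)) (β : Bool) (ρ : Fin k → Fin r)
    (hρ : Function.Injective ρ) (hcl : ∀ i, (a ∈ u (ρ i) ↔ β = true)) :
    Function.Injective
      (fun i : Fin k => Finset.univ.filter fun b : Fin h => a.succAbove b ∈ u (ρ i)) := by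
  intro i i' hii'
  apply hρ
  apply hu
  ext x
  by_cases hx : x = a
  · subst hx
    exact (hcl i).trans (hcl i').symm
  · obtain ⟨b, rfl⟩ := Fin.exists_succAbove_eq hx
    have hb := congrArg (fun s : Finset (Fin h) => b ∈ s) hii'
    simp only [Finset.mem_filter, Finset.mem_univ, true_and] at hb
    exact Iff.of_eq hb

/-- GOOD is invariant under re-indexing the rows and the columns of a layout by bijections. -/
theorem good_of_reindex {h r s : ℕ} (u w : Fin r → Finset (Fin h)) (ρ κ : Fin s ≃ Fin r)
    (hg : ∃ H : Matrix (Fin (h + h)) (Fin (h + h)) ℂ, (Matrix.of fun i j : Fin s =>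
      (H.submatrix (fun a : Fin h => if a ∈ u (ρ i) then Fin.castAdd h a else Fin.natAdd h a)
        (fun c : Fin h => if c ∈ w (κ j) then Fin.natAdd h c else Fin.castAdd h c)).det).det ≠ 0) :
    ∃ H : Matrix (Fin (h + h)) (Fin (h + h)) ℂ, (Matrix.of fun i j : Fin r =>
      (H.submatrix (fun a : Fin h => if a ∈ u i then Fin.castAdd h a else Fin.natAdd h a)
        (fun c : Fin h => if c ∈ w j then Fin.natAdd h c else Fin.castAdd h c)).det).det ≠ 0 := by
  obtain ⟨H, hH⟩ := hg
  refine ⟨H, det_ne_zero_of_submatrix_equiv _ ρ κ ?_⟩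
  have hM : (Matrix.of fun i j : Fin r =>
      (H.submatrix (fun a : Fin h => if a ∈ u i then Fin.castAdd h a else Fin.natAdd h a)
        (fun c : Fin h => if c ∈ w j then Fin.natAdd h c else Fin.castAdd h c)).det).submatrix
        ρ κ = Matrix.of fun i j : Fin s =>
      (H.submatrix (fun a : Fin h => if a ∈ u (ρ i) then Fin.castAdd h a else Fin.natAdd h a)
        (fun c : Fin h => if c ∈ w (κ j) then Fin.natAdd h c else Fin.castAdd h c)).det := by
    ext i j
    rfl
  rw [hM]
  exact hH

/-! ## 2. Dimension zero -/

/-- In dimension `0` an injective layout has at most one row, and its layout matrix (all entries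
are `0 × 0` determinants, i.e. `1`) is nonsingular. -/
theorem good_dim_zero (r : ℕ) (u w : Fin r → Finset (Fin 0)) (hu : Function.Injective u) :
    ∃ H : Matrix (Fin (0 + 0)) (Fin (0 + 0)) ℂ, (Matrix.of fun i j : Fin r =>
      (H.submatrix (fun a : Fin 0 => if a ∈ u i then Fin.castAdd 0 a else Fin.natAdd 0 a)
        (fun c : Fin 0 => if c ∈ w j then Fin.natAdd 0 c else Fin.castAdd 0 c)).det).det ≠ 0 := by
  refine ⟨0, ?_⟩
  have hr : r ≤ 1 := by
    by_contra hlt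
    have hlt : 1 < r := not_le.mp hlt
    have h01 : u ⟨0, by omega⟩ = u ⟨1, hlt⟩ := by
      rw [Finset.eq_empty_of_isEmpty (u _), Finset.eq_empty_of_isEmpty (u _)]
    have h01' := hu h01
    simp only [Fin.mk.injEq] at h01'
    exact absurd h01' (by norm_num)
  have hM : (Matrix.of fun i j : Fin r => ((0 : Matrix (Fin (0 + 0)) (Fin (0 + 0)) ℂ).submatrix
      (fun a : Fin 0 => if a ∈ u i then Fin.castAdd 0 a else Fin.natAdd 0 a)
      (fun c : Fin 0 => if c ∈ w j then Fin.natAdd 0 c else Fin.castAdd 0 c)).det) =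
      Matrix.of fun _ _ : Fin r => (1 : ℂ) := by
    ext i j
    simp only [Matrix.of_apply, Matrix.det_isEmpty]
  rw [hM]
  rcases Nat.le_one_iff_eq_zero_or_eq_one.mp hr with rfl | rfl
  · simp only [Matrix.det_isEmpty, ne_eq, one_ne_zero, not_false_eq_true]
  · rw [Matrix.det_unique]
    simp only [Matrix.of_apply, ne_eq, one_ne_zero, not_false_eq_true]

/-! ## 3. The inductive step -/

/-- The inductive step `h ⇒ h + 1` (inner strong induction on the size `r`): cases (A) R1 with a
nonempty class, (B) R2, (C) the core. -/
theorem good_succ (hR1 : TransversalLiteralPairSplit) (hR2 : TransversalTwinFreeReduction)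
    (hCore : TransversalMinorsNonsingularOnIrreducibleLayouts) (h : ℕ)
    (IH : ∀ (r : ℕ) (u w : Fin r → Finset (Fin h)), Function.Injective u → Function.Injective w →
      ∃ H : Matrix (Fin (h + h)) (Fin (h + h)) ℂ, (Matrix.of fun i j : Fin r =>
        (H.submatrix (fun a : Fin h => if a ∈ u i then Fin.castAdd h a else Fin.natAdd h a)
          (fun c : Fin h => if c ∈ w j then Fin.natAdd h c else Fin.castAdd h c)).det).det ≠ 0) :
    ∀ (r : ℕ) (u w : Fin r → Finset (Fin (h + 1))), Function.Injective u → Function.Injective w →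
      ∃ H : Matrix (Fin ((h + 1) + (h + 1))) (Fin ((h + 1) + (h + 1))) ℂ,
        (Matrix.of fun i j : Fin r =>
          (H.submatrix (fun a : Fin (h + 1) => if a ∈ u i then Fin.castAdd (h + 1) a
              else Fin.natAdd (h + 1) a)
            (fun c : Fin (h + 1) => if c ∈ w j then Fin.natAdd (h + 1) c
              else Fin.castAdd (h + 1) c)).det).det ≠ 0 := by
  intro r
  induction r using Nat.strong_induction_on with
  | h r IHr => ?_
  intro u w hu hw
  -- size 0: the empty matrix
  rcases Nat.eq_zero_or_pos r with rfl | hrpos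
  · exact ⟨0, by simp only [Matrix.det_isEmpty, ne_eq, one_ne_zero, not_false_eq_true]⟩
  by_cases hA : ∃ (a c : Fin (h + 1)) (β γ : Bool),
      (Finset.univ.filter fun i : Fin r => (a ∈ u i ↔ β = true)).card =
        (Finset.univ.filter fun j : Fin r => (c ∈ w j ↔ γ = true)).card
  · /- (A) R1 with a nonempty class -/
    obtain ⟨a, c, β, γ, hk1, hkeq⟩ : ∃ (a c : Fin (h + 1)) (β γ : Bool),
        0 < (Finset.univ.filter fun i : Fin r => (a ∈ u i ↔ β = true)).card ∧
        (Finset.univ.filter fun i : Fin r => (a ∈ u i ↔ β = true)).card =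
          (Finset.univ.filter fun j : Fin r => (c ∈ w j ↔ γ = true)).card := by
      obtain ⟨a, c, β, γ, hk⟩ := hA
      by_cases hpos : 0 < (Finset.univ.filter fun i : Fin r => (a ∈ u i ↔ β = true)).card
      · exact ⟨a, c, β, γ, hpos, hk⟩
      · refine ⟨a, c, !β, !γ, ?_, ?_⟩
        · rw [card_class_not]
          omega
        · rw [card_class_not, card_class_not, hk]
    set A := Finset.univ.filter fun i : Fin r => (a ∈ u i ↔ β = true) with hA_def
    set B := Finset.univ.filter fun j : Fin r => (c ∈ w j ↔ γ = true) with hB_def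
    set k := A.card with hk_def
    set m := r - k with hm_def
    have hkr : k ≤ r := by
      have := Finset.card_le_univ A
      simpa only [Fintype.card_fin] using this
    have hAc : Aᶜ.card = m := by
      rw [Finset.card_compl, Fintype.card_fin]
    have hBc : Bᶜ.card = m := by
      rw [Finset.card_compl, Fintype.card_fin, ← hkeq]
    obtain ⟨ρ, hρA, hρAc⟩ := exists_equiv_classFirst A rfl hAc
    obtain ⟨κ, hκB, hκBc⟩ := exists_equiv_classFirst B hkeq.symm hBc
    -- the re-indexed layout
    have h1 : ∀ i : Fin k, a ∈ u (ρ (Fin.castAdd m i)) ↔ β = true := fun i => by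
      exact (Finset.mem_filter.mp (hρA i)).2
    have h2 : ∀ i : Fin m, a ∈ u (ρ (Fin.natAdd k i)) ↔ β = false := fun i => by
      exact iff_eq_false_of_not_iff (fun hc => hρAc i (Finset.mem_filter.mpr ⟨Finset.mem_univ _, hc⟩))
    have h3 : ∀ j : Fin k, c ∈ w (κ (Fin.castAdd m j)) ↔ γ = true := fun j => by
      exact (Finset.mem_filter.mp (hκB j)).2
    have h4 : ∀ j : Fin m, c ∈ w (κ (Fin.natAdd k j)) ↔ γ = false := fun j => by
      exact iff_eq_false_of_not_iff (fun hc => hκBc j (Finset.mem_filter.mpr ⟨Finset.mem_univ _, hc⟩))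
    -- first block: projected, dimension h, outer induction hypothesis
    have hinjU : Function.Injective (fun i : Fin k =>
        Finset.univ.filter fun b : Fin h => a.succAbove b ∈ u (ρ (Fin.castAdd m i))) :=
      proj_injective_of_class u hu a β (fun i => ρ (Fin.castAdd m i))
        (fun i i' hii' => Fin.castAdd_injective _ _ (ρ.injective hii')) h1
    have hinjW : Function.Injective (fun j : Fin k =>
        Finset.univ.filter fun b : Fin h => c.succAbove b ∈ w (κ (Fin.castAdd m j))) :=
      proj_injective_of_class w hw c γ (fun j => κ (Fin.castAdd m j))
        (fun j j' hjj' => Fin.castAdd_injective _ _ (κ.injective hjj')) h3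
    have hgood1 := IH k _ _ hinjU hinjW
    -- second block: same dimension, size m < r, inner induction hypothesis
    have hmr : m < r := by omega
    have hgood2 := IHr m hmr (fun i => u (ρ (Fin.natAdd k i))) (fun j => w (κ (Fin.natAdd k j)))
      (fun i i' hii' => Fin.natAdd_injective _ _ (ρ.injective (hu hii')))
      (fun j j' hjj' => Fin.natAdd_injective _ _ (κ.injective (hw hjj')))
    -- R1 on the re-indexed layout, then back along the re-indexing
    have hgood := hR1 h k m (fun i => u (ρ i)) (fun j => w (κ j)) a c β γ h1 h2 h3 h4 hgood1 hgood2
    exact good_of_reindex u w ρ κ hgood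
  · by_cases hB : ∃ a c : Fin (h + 1),
        Function.Injective (fun i => Finset.univ.filter fun b : Fin h => a.succAbove b ∈ u i) ∧
        Function.Injective (fun j => Finset.univ.filter fun b : Fin h => c.succAbove b ∈ w j)
    · /- (B) R2 -/
      obtain ⟨a, c, ha, hc⟩ := hB
      exact hR2 h r u w a c ha hc (IH r _ _ ha hc)
    · /- (C) the irreducible core -/
      exact hCore h r u w hu hw (fun a c β γ heq => hA ⟨a, c, β, γ, heq⟩)
        (fun a c ha hc => hB ⟨a, c, ha, hc⟩)

/-! ## 4. The item -/

/-- **Item stmt-ValiantsHypothesis-19617 `SplitReductionSufficesForTransversal`**, stated as the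
route declaration itself: `TransversalLiteralPairSplit → TransversalTwinFreeReduction →
TransversalMinorsNonsingularOnIrreducibleLayouts → TransversalMinorLayoutsNonsingular`. -/
theorem splitReductionSufficesForTransversal : SplitReductionSufficesForTransversal := by
  intro hR1 hR2 hCore
  unfold TransversalMinorLayoutsNonsingular
  intro h
  induction h with
  | zero =>
    intro r u w hu _
    exact good_dim_zero r u w hu
  | succ h IH => exact good_succ hR1 hR2 hCore h IH

end Summit.ValiantsHypothesis.ValiantsHypothesis.Theorems.BarrierLever.SplitGlue
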